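import Literature.AlgebraicGeometry.Motives.HodgeGroupOfCMFamilyRealPointsNondegenerate
import Literature.AlgebraicGeometry.HodgeTheory.CMFamilyBettiMumfordTateReflexNorm
import HarnessLib

/-!
# Hazama / Gordon 7.5 (3) + 2.13 ON REAL POINTS FOR AN ACTUAL PRODUCT OF CM ABELIAN VARIETIES:
# `(Φᵢ)ᵢ` is nondegenerate IFF `Hg(⊕ᵢ H¹(Aᵢ))(ℝ) = E · ∏ᵢ U_{Kᵢ}(ℝ) · E⁻¹`, the full compact unitary torus

Family `hodge`, lane `lit-hodgefound` (Track 2 foundations library; Layer A4 «products of CM abelian varieties»), layer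
`Literature/AlgebraicGeometry/HodgeTheory`, sub-namespace `Literature.AlgebraicGeometry.HodgeTheory.CMBettiModel` (as
`HodgeTheory/CMBettiHodgeGroupSplitTorus`, whose `isNondegenerateFamily_iff_forall_mem_hodgeGroupBaseChange_pi_hodge_complex_iff`
is the `ℂ`-points twin).  THEOREMS ONLY (no definition, no named fact; D-0026 net debt `0`).  A TRANSPORT file: the real-points
criterion `isNondegenerateFamily_iff_forall_mem_hodgeGroupBaseChange_real_iff` of `Motives/HodgeGroupOfCMFamilyRealPointsNondegenerate`
carried to `⊕ᵢ H¹(Aᵢ(ℂ); ℚ)` of an ACTUAL product of CM abelian varieties.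

THE PRINTS.  B. B. Gordon [Gordon1999HodgeAVSurvey] (held `paper:arxiv-alg-geom_9709030`), p0012 **2.13** «nondegenerate if
`dim Hg(A) = dim A = ½[K:ℚ]`», **Remark 2.12** «`h₁(U(1))` is contained in the real points of the indicated kernel»; p0020
**7.5** (Murty–Hazama) «`Hg(A) = Lf(A)` ⟺ `rank Hg(A)_ℂ = rdim A`», 7.6 («`A` is stably nondegenerate iff `Aᵏ` is»), §9.4.
J. S. Milne, *Lefschetz classes on abelian varieties* (1999) [Milne1999LefschetzClasses] Prop. 4.8.  P. Deligne
[Deligne1982HodgeCycles] I Example 3.7 «`A = ∏ Aᵢ`» (pp. 25–26).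

THE OBJECTS.  `hA : ∀ i, IsCMTypeRealisation (Φ i) (A i) (ι i) (θ i)` (CM fields `Kᵢ`, `I ≠ ∅`), `hHD`, `hI`, `H = ⊕ᵢ H¹(Aᵢ) =
HodgeStructure.pi (fun i => BettiUniverse.hodge hHD (hA i).1 1)`, `K`-equivariant `eᵢ : Kᵢ ≃ H¹(Aᵢ; ℚ)` (`he`), `E = 1 ⊗ (⊕ᵢ eᵢ)`
on REAL points (`(LinearEquiv.piCongrRight e).baseChange ℚ ℝ _ _`), `E⁻¹ Γ E = E.trans (Γ.trans E.symm)`, its complexification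
`glExtendScalars ℝ ℂ`, the eigen-basis `e_s` of `ℂ ⊗ ∏ᵢ Kᵢ` (`cmFamilyBasis`); `∏ᵢ U_{Kᵢ}(ℝ)` on points = «diagonal with
`c_s c_{s̄} = 1`»; `CMAlgebra.IsNondegenerateFamily`.

WHAT IS PROVED.  **`isNondegenerateFamily_iff_forall_mem_hodgeGroupBaseChange_pi_hodge_real_iff`** — **`(Φᵢ)ᵢ` is
nondegenerate IFF for every real automorphism `Γ` of `ℝ ⊗ H`: `Γ ∈ Hg(H)(ℝ)` ⟺ `(E⁻¹ Γ E)_ℂ` is diagonal in the eigen-basis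
with eigenvalues `c_s c_{s̄} = 1`** (i.e. `Hg(⊕ᵢ H¹(Aᵢ))(ℝ) = E ∏ᵢ U_{Kᵢ}(ℝ) E⁻¹`), and the unconditional half
`exists_eigenvalues_of_mem_hodgeGroupBaseChange_pi_hodge_real` (`Hg(H)(ℝ) ⊆ E ∏ᵢ U_{Kᵢ}(ℝ) E⁻¹` always).  Mechanism: `Γ ∈ Hg(H)(ℝ)
⟺ E⁻¹ Γ E ∈ Hg(⊕ᵢ V¹)(ℝ)` (the tree's `mem_hodgeGroupBaseChange_pi_hodge_iff ℝ`) and `Γ = E (E⁻¹ Γ E) E⁻¹`.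

DEVIATIONS / SCOPE.  On points, Tannaka-free; a chosen family `e` (any works); `rdim` read as `Σᵢ [Kᵢ:ℚ]/2`.  NOT HERE: a
single `A` (the one-field real criterion is not in the tree yet), `ℓ`-adic points.

## References
* [Gordon1999HodgeAVSurvey] B. B. Gordon, *A survey of the Hodge conjecture for abelian varieties* (1999) — 2.12, 2.13, 7.5,
  7.6, §9.4.
* [Milne1999LefschetzClasses] J. S. Milne, *Lefschetz classes on abelian varieties*, Duke Math. J. 96 (1999) — Prop. 4.8.
* [Deligne1982HodgeCycles] P. Deligne, *Hodge cycles on abelian varieties*, in LNM 900 (1982) — I Example 3.7 (re-edition pp. 25–26).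

## Provenance
Lane `lit-hodgefound` (Hodge path, Track 2), prover seat `lit-hodgefound-p29` (generation 21), self-proposed row g21-#9
(the «NOT HERE: the transport to `H¹(∏ᵢ Aᵢ)`» of the seat's g21-#8 `Motives/HodgeGroupOfCMFamilyRealPointsNondegenerate`).
-/

noncomputable section

open scoped TensorProduct
open NumberField CategoryTheory Module

namespace Literature.AlgebraicGeometry.HodgeTheory

namespace CMBettiModel

open Literature.AlgebraicGeometry.Motives (CMType HodgeStructure AbelianVariety bettiCohomology HodgeTensorFacts glExtendScalars)
open Literature.AlgebraicGeometry.Motives.HodgeStructure (ofCMType ofCMFamily cmFamilyBasis)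
open Literature.AlgebraicGeometry.HodgeTheory.BettiUniverse (cmAction)
open Literature.AlgebraicGeometry.ComplexMultiplication (IsCMTypeRealisation)
open Literature.AlgebraicGeometry.Pohlmann1968 (CMAlgebra.IsNondegenerateFamily)
open scoped Literature.NumberTheory.ComplexMultiplication

section Product

variable {I : Type} [Fintype I] [DecidableEq I] {K : I → Type} [∀ i, Field (K i)] [∀ i, NumberField (K i)]
  [∀ i, IsCMField (K i)] {Φ : ∀ i, CMType (K i)} {A : I → AbelianVariety ℂ} {ι : ∀ i, 𝓞 (K i) →+* End (A i)}
  {θ : ∀ i, K i →+* Module.End ℂ (complexBetti (A i).X 1)} [HodgeTensorFacts.{0, 0}]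
  [∀ i, Module.Finite ℚ (bettiCohomology (A i).X 1)]

/-- **`Hg(⊕ᵢ H¹(Aᵢ))(ℝ) ⊆ E · ∏ᵢ U_{Kᵢ}(ℝ) · E⁻¹` for EVERY family**: a real point `Γ` of the Hodge group of a product of CM
abelian varieties has `(E⁻¹ Γ E)_ℂ` diagonal in the eigen-basis with eigenvalues `c_s c_{s̄} = 1` (Gordon, Remark 2.12:
`Hg(A) ⊆ Ker{Res 𝔾_m → Res 𝔾_m}`). [cite: Gordon1999HodgeAVSurvey, §2 Remark 2.12] [cite: Milne1999LefschetzClasses, Prop. 4.8] -/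
theorem exists_eigenvalues_of_mem_hodgeGroupBaseChange_pi_hodge_real [Nontrivial (∀ i, K i)]
    (hA : ∀ i, IsCMTypeRealisation (Φ i) (A i) (ι i) (θ i)) (hHD : exists_isReal_hodgeModel)
    (hI : hodgePQ_independent_of_hodgeModel) (e : ∀ i, K i ≃ₗ[ℚ] bettiCohomology (A i).X 1)
    (he : ∀ i k x, e i (k * x) = cmAction (θ i) (hA i).isInducedOnIntegers k (e i x))
    {Γ : (ℝ ⊗[ℚ] (∀ i, bettiCohomology (A i).X 1)) ≃ₗ[ℝ] (ℝ ⊗[ℚ] (∀ i, bettiCohomology (A i).X 1))}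
    (hΓ : Γ ∈ (HodgeStructure.pi fun i => BettiUniverse.hodge hHD (hA i).1 1).hodgeGroupBaseChange ℝ) :
    ∃ c : ((i : I) × (K i →+* ℂ)) → ℂ,
      (∀ s, glExtendScalars ℝ ℂ (∀ i, K i) (((LinearEquiv.piCongrRight e).baseChange ℚ ℝ _ _).trans
          (Γ.trans ((LinearEquiv.piCongrRight e).baseChange ℚ ℝ _ _).symm)) (cmFamilyBasis K s) = c s • cmFamilyBasis K s) ∧
        ∀ s, c s * c ((starRingAut : ℂ ≃+* ℂ) • s) = 1 := by
  rw [mem_hodgeGroupBaseChange_pi_hodge_iff ℝ hA hHD hI e he Γ] at hΓ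
  obtain ⟨c, hγc, -⟩ := (HodgeStructure.mem_hodgeGroupBaseChange_real_ofCMFamily_iff Φ _).1 hΓ
  exact ⟨c, hγc, HodgeStructure.mul_apply_conj_smul_eq_one_of_mem_hodgeGroupBaseChange_real Φ hΓ hγc⟩

/-- **Hazama / Gordon 7.5 (3) + 2.13 ON REAL POINTS for `A = ∏ᵢ Aᵢ` of CM type: `(Φᵢ)ᵢ` is nondegenerate IFF
`Hg(⊕ᵢ H¹(Aᵢ(ℂ); ℚ))(ℝ) = E · ∏ᵢ U_{Kᵢ}(ℝ) · E⁻¹`** — `Γ ∈ Hg(⊕ᵢ H¹(Aᵢ))(ℝ)` iff `(E⁻¹ Γ E)_ℂ` is diagonal in the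
eigen-basis of `ℂ ⊗ ∏ᵢ Kᵢ` with eigenvalues `c_s c_{s̄} = 1`, for every real automorphism `Γ` («`dim Hg(A) = dim A`», «`Hg(A) =
Lf(A)` ⟺ `rank Hg(A)_ℂ = rdim A`», on the compact real forms; the model statement
`isNondegenerateFamily_iff_forall_mem_hodgeGroupBaseChange_real_iff` read through `mem_hodgeGroupBaseChange_pi_hodge_iff ℝ`).
[cite: Gordon1999HodgeAVSurvey, §2 Definition 2.13, 7.5 (3), 7.6, §9.4] [cite: Milne1999LefschetzClasses, Prop. 4.8 and p. 23] -/
theorem isNondegenerateFamily_iff_forall_mem_hodgeGroupBaseChange_pi_hodge_real_iff [Nontrivial (∀ i, K i)]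
    (hA : ∀ i, IsCMTypeRealisation (Φ i) (A i) (ι i) (θ i)) (hHD : exists_isReal_hodgeModel)
    (hI : hodgePQ_independent_of_hodgeModel) (e : ∀ i, K i ≃ₗ[ℚ] bettiCohomology (A i).X 1)
    (he : ∀ i k x, e i (k * x) = cmAction (θ i) (hA i).isInducedOnIntegers k (e i x)) :
    CMAlgebra.IsNondegenerateFamily Φ ↔
      ∀ Γ : (ℝ ⊗[ℚ] (∀ i, bettiCohomology (A i).X 1)) ≃ₗ[ℝ] (ℝ ⊗[ℚ] (∀ i, bettiCohomology (A i).X 1)),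
        Γ ∈ (HodgeStructure.pi fun i => BettiUniverse.hodge hHD (hA i).1 1).hodgeGroupBaseChange ℝ ↔
          ∃ c : ((i : I) × (K i →+* ℂ)) → ℂ,
            (∀ s, glExtendScalars ℝ ℂ (∀ i, K i) (((LinearEquiv.piCongrRight e).baseChange ℚ ℝ _ _).trans
                (Γ.trans ((LinearEquiv.piCongrRight e).baseChange ℚ ℝ _ _).symm)) (cmFamilyBasis K s) =
              c s • cmFamilyBasis K s) ∧
            ∀ s, c s * c ((starRingAut : ℂ ≃+* ℂ) • s) = 1 := by
  rw [HodgeStructure.isNondegenerateFamily_iff_forall_mem_hodgeGroupBaseChange_real_iff Φ]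
  constructor
  · intro hΦ Γ
    rw [mem_hodgeGroupBaseChange_pi_hodge_iff ℝ hA hHD hI e he Γ]
    exact hΦ _
  · intro hP γ
    set E := (LinearEquiv.piCongrRight e).baseChange ℚ ℝ (∀ i, K i) (∀ i, bettiCohomology (A i).X 1) with hE
    have hγ : γ = E.trans (((E.symm.trans (γ.trans E)).trans E.symm)) := by
      ext x
      simp only [LinearEquiv.trans_apply, LinearEquiv.symm_apply_apply]
    have h1 := hP (E.symm.trans (γ.trans E))
    rw [mem_hodgeGroupBaseChange_pi_hodge_iff ℝ hA hHD hI e he, ← hE, ← hγ] at h1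
    exact h1

end Product

end CMBettiModel

end Literature.AlgebraicGeometry.HodgeTheory

end
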